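import Summits.Ventures.PercRepro.SMC
import Summits.Ventures.PercRepro.C012Partial

/-!
# C-012 ⇐ (MED): the determinant form of the C-012 slack — and (MED) is FALSE (`MEDRefutation.lean`)

Row C-012 (`PercRepro.C012`, typer-2 SMC.lean) on the rows `x = P(abc), y₁ = P(ab|c),
y₂ = P(ac|b), y₃ = P(bc|a), z = P(a|b|c)` reads `(z + y₁)(y₂ + x) ≤ (y₁ + y₂ + y₃)(x + z)`.

* `med_identity`: with `S` = the C-012 slack and `det = x·z − y₁·y₂`
  (`= P(abc)P(a|b|c) − P(ab|c)P(ac|b)`, the 2×2 determinant of the table `(a~b | b iso) × (a~c | a≁c)`),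
  `S·(x + y₁)(y₂ + z) = y₃(x + z)(x + y₁)(y₂ + z) − det² + (y₁z − x y₂)²`.
* `MED : Prop` — **the determinant inequality** `det² ≤ y₃·(x + z)·(x + y₁)·(y₂ + z)`, i.e.
  `P(ab)·P(b iso)·(P(ac | ab) − P(ac | b iso))² ≤ P(bc|a)·(P(abc) + P(a|b|c))`: the influence of
  `b`'s status on the `a–c` connection, squared, is paid by `P(bc|a)·P(all or none)`.
  Sharp (ratio → 1 on the path `a–b–c` with `P(ab) → 1`, `P(bc) → 0`, `P(a≁b) ≪ P(bc)`).
* `C012_of_MED : MED → C012` (drop the square `(y₁z − xy₂)²`); `c012_real_iff_det` / `C012_iff_det`: C-012 is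
  EXACTLY `det² ≤ y₃(x+z)(x+y₁)(y₂+z) + (y₁z − xy₂)²` (the square is essential — `MED` drops it and is false).
* `med_det_sq_le_row3`: `MED` gives `(x·z − y₁·y₂)² ≤ y₃` for every marked triple — instantiated at
  `(c, b, a)` this is `(P(abc)P(a|b|c) − P(ac|b)P(a|bc))² ≤ P(ab|c)`, a Hölder-½ modulus for
  Gladkov's Conjecture 10.1 [arXiv:2408.08457 §10] (`P(ab|c) < δ ⇒ P(abc)P(a|b|c) − P(ac|b)P(a|bc) < √δ`).

Paper note: `proofs/P5-MED.md`. STATUS: `MED` is REFUTED — `MEDRefutation.lean` (`not_MED`, kernel-checked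
on a 6-vertex, 7-edge witness; the pendant-`t` degeneration of a `(COV)` witness, `P5-MED.md` §7). The
implications below are correct but their hypothesis is false; they are kept as the exact algebra behind
C-012 (`med_identity`: C-012 ⟺ `det² ≤ y₃(x+z)(x+y₁)(y₂+z) + (y₁z − xy₂)²`, and the square cannot be
dropped). The Hölder-½ modulus for Gladkov 10.1 survives only as a conjecture with an unknown constant
`C` (`det² ≤ C·y₃(x+z)(x+y₁)(y₂+z)`; `C ≥ 1.001` is forced by the witnesses).
-/

namespace PercRepro

open Finset

/-- The determinant identity behind C-012:
`S·(x + y₁)(y₂ + z) = y₃(x + z)(x + y₁)(y₂ + z) − (xz − y₁y₂)² + (y₁z − xy₂)²`. -/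
theorem med_identity (x y₁ y₂ y₃ z : ℝ) :
    ((y₁ + y₂ + y₃) * (x + z) - (z + y₁) * (y₂ + x)) * ((x + y₁) * (y₂ + z)) =
      y₃ * (x + z) * (x + y₁) * (y₂ + z) - (x * z - y₁ * y₂) ^ 2 + (y₁ * z - x * y₂) ^ 2 := by
  ring

/-- Pure real arithmetic: nonnegative reals with `(xz − y₁y₂)² ≤ y₃(x + z)(x + y₁)(y₂ + z)`
satisfy the C-012 inequality `(z + y₁)(y₂ + x) ≤ (y₁ + y₂ + y₃)(x + z)`. -/
theorem c012_real_of_med {x y₁ y₂ y₃ z : ℝ} (hx : 0 ≤ x) (hy₁ : 0 ≤ y₁) (hy₂ : 0 ≤ y₂)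
    (hy₃ : 0 ≤ y₃) (hz : 0 ≤ z)
    (h : (x * z - y₁ * y₂) ^ 2 ≤ y₃ * (x + z) * (x + y₁) * (y₂ + z)) :
    (z + y₁) * (y₂ + x) ≤ (y₁ + y₂ + y₃) * (x + z) := by
  rcases eq_or_lt_of_le (mul_nonneg (add_nonneg hx hy₁) (add_nonneg hy₂ hz)) with h0 | hpos
  · -- a degenerate row: `x + y₁ = 0` or `y₂ + z = 0`
    rcases mul_eq_zero.1 h0.symm with h1 | h1
    · have hx0 : x = 0 := by linarith
      have hy10 : y₁ = 0 := by linarith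
      subst hx0 hy10
      nlinarith [mul_nonneg hy₃ hz]
    · have hy20 : y₂ = 0 := by linarith
      have hz0 : z = 0 := by linarith
      subst hy20 hz0
      nlinarith [mul_nonneg hy₃ hx]
  · have key := med_identity x y₁ y₂ y₃ z
    have hsq : 0 ≤ (y₁ * z - x * y₂) ^ 2 := sq_nonneg _
    have : 0 ≤ ((y₁ + y₂ + y₃) * (x + z) - (z + y₁) * (y₂ + x)) * ((x + y₁) * (y₂ + z)) := by
      rw [key]; linarith
    have := nonneg_of_mul_nonneg_left this hpos
    linarith

/-- **(MED)** — the determinant inequality on the rows of the marked triple `(a, b, c)`: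
`(P(abc)P(a|b|c) − P(ab|c)P(ac|b))² ≤ P(bc|a)·(P(abc) + P(a|b|c))·P(a ~ b)·P(b iso)`
(`P(a ~ b) = x + y₁`, `P(b isolated from a and c) = y₂ + z`). Equivalently
`P(ab)·P(b iso)·(P(ac | ab) − P(ac | b iso))² ≤ P(bc|a)·P(all or none)`.
Implies C-012 (`C012_of_MED`) and, in every relabelling, bounds
`P(abc)P(a|b|c) − P(ab|c)P(ac|b)` by `√P(bc|a)` (`med_det_sq_le_row3`). **FALSE**: `Examples.not_MED`
(`MEDRefutation.lean`), relative margin `1.3·10⁻⁴` in the regime `a ≡ c`, `b` pendant of weight `10⁻⁸`. -/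
def MED : Prop :=
  ∀ {V E : Type} [Fintype E] [DecidableEq E] (G : MultiGraph V E) (p : E → ℝ), IsProb p →
    ∀ a b c : V,
      (G.law3 p a b c 0 * G.law3 p a b c 4 - G.law3 p a b c 1 * G.law3 p a b c 2) ^ 2 ≤
        G.law3 p a b c 3 * (G.law3 p a b c 0 + G.law3 p a b c 4) *
          (G.law3 p a b c 0 + G.law3 p a b c 1) * (G.law3 p a b c 2 + G.law3 p a b c 4)

/-- **C-012 follows from (MED)**: drop the square `(y₁z − xy₂)²` in `med_identity`. -/
theorem C012_of_MED (h : MED) : C012 := by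
  intro V E _ _ G p hp a b c
  have hm := h G p hp a b c
  exact c012_real_of_med (prob_nonneg hp _) (prob_nonneg hp _) (prob_nonneg hp _)
    (prob_nonneg hp _) (prob_nonneg hp _) hm


/-- **C-012 in determinant form (exact, real level)**: for nonnegative reals,
`(z + y₁)(y₂ + x) ≤ (y₁ + y₂ + y₃)(x + z)` ⟺ `(xz − y₁y₂)² ≤ y₃(x + z)(x + y₁)(y₂ + z) + (y₁z − xy₂)²`
(both sides hold trivially when `(x + y₁)(y₂ + z) = 0`). -/
theorem c012_real_iff_det {x y₁ y₂ y₃ z : ℝ} (hx : 0 ≤ x) (hy₁ : 0 ≤ y₁) (hy₂ : 0 ≤ y₂)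
    (hy₃ : 0 ≤ y₃) (hz : 0 ≤ z) :
    (z + y₁) * (y₂ + x) ≤ (y₁ + y₂ + y₃) * (x + z) ↔
      (x * z - y₁ * y₂) ^ 2 ≤ y₃ * (x + z) * (x + y₁) * (y₂ + z) + (y₁ * z - x * y₂) ^ 2 := by
  have key := med_identity x y₁ y₂ y₃ z
  rcases eq_or_lt_of_le (mul_nonneg (add_nonneg hx hy₁) (add_nonneg hy₂ hz)) with h0 | hpos
  · -- degenerate row: both sides hold
    rcases mul_eq_zero.1 h0.symm with h1 | h1
    · have hx0 : x = 0 := by linarith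
      have hy10 : y₁ = 0 := by linarith
      subst hx0 hy10
      constructor
      · intro _; nlinarith [mul_nonneg hy₃ hz, mul_nonneg hy₂ hz]
      · intro _; nlinarith [mul_nonneg hy₃ hz]
    · have hy20 : y₂ = 0 := by linarith
      have hz0 : z = 0 := by linarith
      subst hy20 hz0
      constructor
      · intro _; nlinarith [mul_nonneg hy₃ hx, mul_nonneg hy₁ hx]
      · intro _; nlinarith [mul_nonneg hy₃ hx]
  · constructor
    · intro h
      have hS : 0 ≤ (y₁ + y₂ + y₃) * (x + z) - (z + y₁) * (y₂ + x) := by linarith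
      have := mul_nonneg hS hpos.le
      rw [key] at this
      linarith
    · intro h
      have : 0 ≤ ((y₁ + y₂ + y₃) * (x + z) - (z + y₁) * (y₂ + x)) * ((x + y₁) * (y₂ + z)) := by
        rw [key]; linarith
      have := nonneg_of_mul_nonneg_left this hpos
      linarith

/-- **C-012 ⟺ its determinant form**, on the rows of every marked triple. -/
theorem C012_iff_det : C012 ↔
    ∀ {V E : Type} [Fintype E] [DecidableEq E] (G : MultiGraph V E) (p : E → ℝ), IsProb p →
      ∀ a b c : V,
        (G.law3 p a b c 0 * G.law3 p a b c 4 - G.law3 p a b c 1 * G.law3 p a b c 2) ^ 2 ≤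
          G.law3 p a b c 3 * (G.law3 p a b c 0 + G.law3 p a b c 4) *
              (G.law3 p a b c 0 + G.law3 p a b c 1) * (G.law3 p a b c 2 + G.law3 p a b c 4) +
            (G.law3 p a b c 1 * G.law3 p a b c 4 - G.law3 p a b c 0 * G.law3 p a b c 2) ^ 2 := by
  constructor
  · intro h V E _ _ G p hp a b c
    exact (c012_real_iff_det (prob_nonneg hp _) (prob_nonneg hp _) (prob_nonneg hp _)
      (prob_nonneg hp _) (prob_nonneg hp _)).1 (h G p hp a b c)
  · intro h V E _ _ G p hp a b c
    exact (c012_real_iff_det (prob_nonneg hp _) (prob_nonneg hp _) (prob_nonneg hp _)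
      (prob_nonneg hp _) (prob_nonneg hp _)).2 (h G p hp a b c)

namespace MultiGraph

variable {V E : Type} [Fintype E] [DecidableEq E] (G : MultiGraph V E)

/-- `P(a ~ b) = x + y₁` in the rows of `triLaw`. -/
theorem prob_connEvent_ab_eq (p : E → ℝ) (a b c : V) :
    prob p (G.connEvent a b) = G.triLaw p a b c 0 + G.triLaw p a b c 1 := by
  have h := prob_inter_add_prob_inter_compl p (G.connEvent a b) (G.connEvent b c)
  rw [← h]
  rfl

/-- `x + z ≤ 1`: the events `abc` and `a|b|c` are disjoint. -/
theorem triLaw_zero_add_four_le_one {p : E → ℝ} (hp : IsProb p) (a b c : V) :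
    G.triLaw p a b c 0 + G.triLaw p a b c 4 ≤ 1 := by
  have hd : Disjoint (G.triEvent a b c 0) (G.triEvent a b c 4) := by
    rw [Set.disjoint_left]
    intro ω h0 h4
    exact h4.1.1 h0.1
  have := prob_union_of_disjoint p hd
  have hle := prob_le_one hp (G.triEvent a b c 0 ∪ G.triEvent a b c 4)
  simp only [triLaw]
  linarith

/-- **Hölder-½ form of Gladkov's Conjecture 10.1 from (MED)**: for every marked triple,
`(P(abc)P(a|b|c) − P(ab|c)P(ac|b))² ≤ P(bc|a)`. (At the triple `(c, b, a)` this reads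
`(P(abc)P(a|b|c) − P(ac|b)P(a|bc))² ≤ P(ab|c)`, Gladkov's form.) -/
theorem med_det_sq_le_row3 (h : MED) {p : E → ℝ} (hp : IsProb p) (a b c : V) :
    (G.law3 p a b c 0 * G.law3 p a b c 4 - G.law3 p a b c 1 * G.law3 p a b c 2) ^ 2 ≤
      G.law3 p a b c 3 := by
  have hm := h G p hp a b c
  rw [law3_eq_triLaw] at hm ⊢
  have h04 := G.triLaw_zero_add_four_le_one hp a b c
  have h01 : G.triLaw p a b c 0 + G.triLaw p a b c 1 ≤ 1 := by
    rw [← G.prob_connEvent_ab_eq p a b c]; exact prob_le_one hp _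
  have h24 : G.triLaw p a b c 2 + G.triLaw p a b c 4 ≤ 1 := by
    rw [← G.prob_biso_eq p a b c]; exact prob_le_one hp _
  have n0 : 0 ≤ G.triLaw p a b c 0 := prob_nonneg hp _
  have n1 : 0 ≤ G.triLaw p a b c 1 := prob_nonneg hp _
  have n2 : 0 ≤ G.triLaw p a b c 2 := prob_nonneg hp _
  have n3 : 0 ≤ G.triLaw p a b c 3 := prob_nonneg hp _
  have n4 : 0 ≤ G.triLaw p a b c 4 := prob_nonneg hp _
  calc (G.triLaw p a b c 0 * G.triLaw p a b c 4 - G.triLaw p a b c 1 * G.triLaw p a b c 2) ^ 2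
      ≤ G.triLaw p a b c 3 * (G.triLaw p a b c 0 + G.triLaw p a b c 4) *
          (G.triLaw p a b c 0 + G.triLaw p a b c 1) * (G.triLaw p a b c 2 + G.triLaw p a b c 4) := hm
    _ ≤ G.triLaw p a b c 3 * 1 * 1 * 1 := by
          gcongr
    _ = G.triLaw p a b c 3 := by ring

end MultiGraph

end PercRepro
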